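import Literature.NumberTheory.Automorphic.SupercuspidalPlaceNonvanishing
import Literature.NumberTheory.Automorphic.UnipotentAveragesLocalPlace
import Literature.NumberTheory.Automorphic.SupercuspidalTestFunctions
import Literature.NumberTheory.Automorphic.AdicCompletionLocalField
import HarnessLib

/-!
# Test functions of supercusp type at a supercuspidal place: `Φ = θ^{(w)} ⊗ ξ_w` kills the
# orthocomplement of the cusp forms and does not kill a constituent with local component `ρ` at `w`
(Gelbart, *Automorphic forms on adele groups* (1975), §10, pp. 151–153: `Φ_f = ∏_{v ∈ S} f_v ⊗ f`
with `f_v` a supercusp form, "`R^ψ(Φ_f)` … its range lies in `L₀²`" and "`M ≠ 0`";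
Jacquet–Langlands, LNM 114 (1970), §16, p. 503)

Topic `NumberTheory/Automorphic`; theorems only (no definition, no named fact, no instance
visible to importers). Assembly of three bricks of the tree:

* `SupercuspidalTestFunctions.exists_supercuspTestFunction_invariant` — at a finite place `w`, for a
  smooth supercuspidal `ρ` and `0 ≠ x ∈ V_ρ`: a test function `ξ ∈ C_c(GL_n(K_w))` with vanishing
  unipotent averages (a supercusp form), right invariant under a compact open `U ≤ Stab(x)`, and a
  smooth linear form `ũ` with `∫ ξ(g) ũ(ρ(g) x) dg ≠ 0`;
* `UnipotentAveragesLocalPlace.integral_comp_glUnipotent_eq_zero_of_place` — vanishing of the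
  unipotent averages of a function on `GL_n(𝔸_K)` along `ι_w(N_k(K_w))` implies their vanishing
  along `N_k(𝔸_K)` (the hypothesis `(H_k)` of `SupercuspTypeCuspidalImage`);
* `SupercuspidalPlaceNonvanishing.exists_nhds_integratedOperator_localTestFunction_ne_zero` — the
  product test functions `Φ_{θ,ξ}(g) = θ(s g) ξ(g_w)` and the non-vanishing of `R(Φ_{θ,ξ})` on a
  constituent with local component `ρ` at `w`.

Results:

* `localTestFunction_mul_toAdelic_mul` — `Φ_{θ,ξ}(p ι_w(u) r) = θ(s(p) s(r)) ξ(p_w u r_w)`.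
* `integral_localTestFunction_comp_glUnipotent_eq_zero` — **if `ξ` is a supercusp form at `w`
  then `Φ_{θ,ξ}` satisfies `(H_k)`**: `∫_{𝔫_k(𝔸_K)} Φ_{θ,ξ}(p (1 + Y) r) dY = 0` for all `p, r`
  and every Haar measure — so `R(Φ_{θ,ξ})` has cuspidal image
  (`integratedOperator_rightRegular_mem_cuspidalSubspace`).
* `exists_localTestFunction_of_hasLocalComponentAt_supercuspidal` — **for a closed
  subrepresentation `Π ≤ L²(GL_n(K) A_G \ GL_n(𝔸_K))` with an irreducible smooth supercuspidal
  local component `ρ` at `w` (`HasLocalComponentAt Π w ρ`) there is a supercusp form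
  `ξ ∈ C_c(GL_n(K_w))` such that every `Φ_{θ,ξ}` satisfies all `(H_k)`, `0 < k < n`, and
  `R(Φ_{θ,ξ})|_Π ≠ 0` for all continuous compactly supported `θ ≥ 0`, `θ(1) > 0`, supported in a
  suitable neighbourhood of `1`** (Gelbart p. 153: the operator `R₀^ψ(Φ_f)` is non-zero exactly on
  the constituents `π^i` with `π^i_v ≅ π_v`, here the non-vanishing half).

## References

* S. Gelbart, *Automorphic forms on adele groups*, Ann. of Math. Studies 83 (1975), §10,
  pp. 151–153 [Gelbart1975].
* H. Jacquet, R. P. Langlands, *Automorphic forms on `GL(2)`*, LNM 114 (1970), §16, p. 503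
  [JacquetLanglands1970].
-/

noncomputable section

open MeasureTheory Measure Set Filter Topology IsDedekindDomain NumberField CompactlySupported
open scoped Pointwise

namespace Literature.NumberTheory.Automorphic

/-! ### `Φ_{θ,ξ}` is of supercusp type when `ξ` is a supercusp form -/

section SupercuspType

variable {n k : ℕ} {K : Type} [Field K] [NumberField K] {w : HeightOneSpectrum (𝓞 K)}

/-- `Φ_{θ,ξ}(p ι_w(u) r) = θ(s(p) s(r)) · ξ(p_w u r_w)` (`s` is a homomorphism trivial on
`ι_w(GL_n(K_w))`, and `(·)_w` is a homomorphism with `(ι_w u)_w = u`). [folklore] -/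
theorem localTestFunction_mul_toAdelic_mul (θ : (AdelicGroupData.gl n K).Adelic → ℝ)
    (ξ : GL (Fin n) (w.adicCompletion K) → ℂ) (p r : (AdelicGroupData.gl n K).Adelic)
    (u : GL (Fin n) (w.adicCompletion K)) :
    localTestFunction w θ ξ (p * GLn.toAdelic n K w u * r) =
      (θ (GLn.awayFrom n K w p * GLn.awayFrom n K w r) : ℂ) *
        ξ (GLn.toLocalAt n K w p * u * GLn.toLocalAt n K w r) := by
  rw [localTestFunction_apply, GLn.awayFrom_mul, GLn.awayFrom_mul, GLn.awayFrom_toAdelic, mul_one,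
    map_mul, map_mul, GLn.toLocal_toAdelic]

/-- **`Φ_{θ,ξ}` satisfies `(H_k)` when `ξ` is a supercusp form at `w`**: if
`∫_{𝔫_k(K_w)} ξ(a (1 + Y) b) dY = 0` for all `a, b ∈ GL_n(K_w)` (some Borel structure and additive
Haar measure on `𝔫_k(K_w)`), then `∫_{𝔫_k(𝔸_K)} Φ_{θ,ξ}(p (1 + Y) r) dY = 0` for all
`p, r ∈ GL_n(𝔸_K)` and every additive Haar measure on `𝔫_k(𝔸_K)`
(`integral_comp_glUnipotent_eq_zero_of_place` with
`Φ_{θ,ξ}(p ι_w(u) r) = θ(s(p) s(r)) ξ(p_w u r_w)`). [cite: JacquetLanglands1970, §16 p. 503] -/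
theorem integral_localTestFunction_comp_glUnipotent_eq_zero
    {θ : (AdelicGroupData.gl n K).Adelic → ℝ} (hθ : Continuous θ) (hθs : HasCompactSupport θ)
    {ξ : GL (Fin n) (w.adicCompletion K) → ℂ} (hξ : Continuous ξ) (hξs : HasCompactSupport ξ)
    [MeasurableSpace (blockNilpotent n k (w.adicCompletion K))]
    [BorelSpace (blockNilpotent n k (w.adicCompletion K))]
    (αw : Measure (blockNilpotent n k (w.adicCompletion K))) [αw.IsAddHaarMeasure]
    (hξ0 : ∀ a b : GL (Fin n) (w.adicCompletion K),
      ∫ Y, ξ (a * unipotentOfBlock n k (w.adicCompletion K) (Multiplicative.ofAdd Y) * b) ∂αw = 0)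
    (ν : Measure (blockNilpotent n k (AdeleRing (𝓞 K) K))) [ν.IsAddHaarMeasure]
    (p r : (AdelicGroupData.gl n K).Adelic) :
    ∫ Y, localTestFunction w θ ξ (p * glUnipotent n k K (Multiplicative.ofAdd Y) * r) ∂ν = 0 := by
  refine integral_comp_glUnipotent_eq_zero_of_place w (GLn.toAdelic n K w) (fun _ => rfl)
    (continuous_localTestFunction hθ hξ) (hasCompactSupport_localTestFunction hθs hξs) αw
    (fun p r => ?_) ν p r
  simp_rw [localTestFunction_mul_toAdelic_mul]
  rw [integral_const_mul, hξ0, mul_zero]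

end SupercuspType

/-! ### Supercuspidal local components -/

section Cuspidal

variable {n : ℕ} {K : Type} [Field K] [NumberField K] {w : HeightOneSpectrum (𝓞 K)}
  {μ : Measure (AdelicGroupData.gl n K).automorphicQuotient}
  [(AdelicGroupData.gl n K).IsAutomorphicMeasure μ]

attribute [local instance] adelicBorel borelSpace_adelic locallyCompactSpace_adelic
  secondCountableTopology_gl_adelic

/-- **Test functions at a supercuspidal place of a constituent** (Gelbart (1975), §10,
pp. 151–153; Jacquet–Langlands (1970), §16, p. 503). Let `Π` be a closed subrepresentation of
`L²(GL_n(K) A_G \\ GL_n(𝔸_K))` (`0 < n`) and `ρ` an irreducible smooth supercuspidal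
representation of `GL_n(K_w)` which is a local component of `Π` at the finite place `w`
(`HasLocalComponentAt Π w ρ`). There is `ξ ∈ C_c(GL_n(K_w))` such that
(i) for **every** weight `θ` the product test function `Φ_{θ,ξ}(g) = θ(s g) ξ(g_w)` has vanishing
unipotent averages `∫_{𝔫_k(𝔸_K)} Φ_{θ,ξ}(p (1 + Y) r) dY = 0`, `0 < k < n` (so `R(Φ_{θ,ξ})` has
cuspidal image, `integratedOperator_rightRegular_mem_cuspidalSubspace`), and
(ii) there is a neighbourhood `N` of `1` in `GL_n(𝔸_K)` such that `R(Φ_{θ,ξ}) y ≠ 0` for some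
`y ∈ Π`, for every continuous compactly supported `θ ≥ 0` with `θ(1) > 0` supported in `N`.
[cite: Gelbart1975, §10 pp. 151–153] -/
theorem exists_localTestFunction_of_hasLocalComponentAt_supercuspidal (hn : 0 < n)
    (W : ContRepresentation.ClosedSubrep ((AdelicGroupData.gl n K).rightRegular μ))
    {V : Type*} [AddCommGroup V] [Module ℂ V]
    {ρ : Representation ℂ (GL (Fin n) (w.adicCompletion K)) V}
    (hρ : ρ.IsIrreducible) (hρs : ρ.IsSmooth) (hρc : ρ.IsSupercuspidal)
    (hW : HasLocalComponentAt W w ρ) :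
    ∃ ξ : C_c(GL (Fin n) (w.adicCompletion K), ℂ),
      (∀ k, 0 < k → k < n → ∀ (θ : (AdelicGroupData.gl n K).Adelic → ℝ), Continuous θ →
        HasCompactSupport θ →
        ∀ (ν : Measure (blockNilpotent n k (AdeleRing (𝓞 K) K))) [ν.IsAddHaarMeasure]
          (p r : (AdelicGroupData.gl n K).Adelic),
          ∫ Y, localTestFunction w θ ξ (p * glUnipotent n k K (Multiplicative.ofAdd Y) * r) ∂ν = 0) ∧
      ∃ N ∈ 𝓝 (1 : (AdelicGroupData.gl n K).Adelic),
        ∀ (θ : (AdelicGroupData.gl n K).Adelic → ℝ) (hθ : Continuous θ) (hθs : HasCompactSupport θ),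
          0 ≤ θ → 0 < θ 1 → Function.support θ ⊆ N →
          ∃ y : W.toSubmodule,
            ((AdelicGroupData.gl n K).rightRegular μ).integratedOperator
              ((AdelicGroupData.gl n K).isUnitary_rightRegular μ)
              ((AdelicGroupData.gl n K).isStronglyContinuous_rightRegular_holds μ) (adelicHaar n K)
              (localTestFunctionCc hθ hθs ξ.continuous ξ.hasCompactSupport)
              ((y : W.toSubmodule) : (AdelicGroupData.gl n K).L2 μ) ≠ 0 := by
  classical
  obtain ⟨F, hF0, hF⟩ := hW
  have hF' : ∀ (a : GL (Fin n) (w.adicCompletion K)) (x : V),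
      F (ρ a x) = W.toContRep (GLn.toAdelic n K w a) (F x) := hF
  -- a vector with `F x ≠ 0`
  obtain ⟨x, hx⟩ : ∃ x, F x ≠ 0 := by
    by_contra h
    push Not at h
    exact hF0 (LinearMap.ext h)
  have hx0 : x ≠ 0 := fun h => hx (by rw [h, map_zero])
  -- a Borel structure and a Haar measure on `GL_n(K_w)`
  haveI : T2Space (Matrix (Fin n) (Fin n) (w.adicCompletion K)) :=
    inferInstanceAs (T2Space (Fin n → Fin n → w.adicCompletion K))
  haveI : LocallyCompactSpace (Matrix (Fin n) (Fin n) (w.adicCompletion K)) :=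
    inferInstanceAs (LocallyCompactSpace (Fin n → Fin n → w.adicCompletion K))
  haveI : LocallyCompactSpace (GL (Fin n) (w.adicCompletion K)) := inferInstance
  letI : MeasurableSpace (GL (Fin n) (w.adicCompletion K)) := borel _
  haveI : BorelSpace (GL (Fin n) (w.adicCompletion K)) := ⟨rfl⟩
  set μw : Measure (GL (Fin n) (w.adicCompletion K)) := Measure.haar with hμw
  obtain ⟨ut, -, ξ, hξ0, hne, U, hUo, hUc, hUfix, hξU⟩ :=
    exists_supercuspTestFunction_invariant ρ hn hρs hρc hx0 μw
  have hUx : U ≤ ρ.stabilizerSubgroup x := fun u hu => (ρ.mem_stabilizerSubgroup x u).2 (hUfix u hu)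
  refine ⟨ξ, fun k hk hkn θ hθ hθs ν _ p r => ?_, ?_⟩
  · -- (i) supercusp type
    letI : MeasurableSpace (blockNilpotent n k (w.adicCompletion K)) := borel _
    haveI : BorelSpace (blockNilpotent n k (w.adicCompletion K)) := ⟨rfl⟩
    haveI : LocallyCompactSpace (blockNilpotent n k (w.adicCompletion K)) :=
      (isClosed_coe_blockNilpotent_local (n := n) (k := k)
        (F := w.adicCompletion K)).isClosedEmbedding_subtypeVal.locallyCompactSpace
    set αw : Measure (blockNilpotent n k (w.adicCompletion K)) := Measure.addHaar with hαw
    exact integral_localTestFunction_comp_glUnipotent_eq_zero hθ hθs ξ.continuous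
      ξ.hasCompactSupport αw (hξ0 k hk hkn αw) ν p r
  · -- (ii) non-vanishing
    obtain ⟨N, hN, hmain⟩ := exists_nhds_integratedOperator_localTestFunction_ne_zero W hρ hF0 hF'
      ⟨hUc, hUo⟩ hUx ξ.continuous ξ.hasCompactSupport hξU ut μw hne
    exact ⟨N, hN, fun θ hθ hθs hθ0 hθ1 hθN => ⟨F x, hmain θ hθ hθs hθ0 hθ1 hθN⟩⟩

end Cuspidal

end Literature.NumberTheory.Automorphic
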